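/-
Copyright (c) 2026. All rights reserved.
Released under Apache 2.0 license as described in the file LICENSE.
-/
import Literature.NumberTheory.ComplexMultiplication.DegenerateCMTypesElementaryAbelianWeightTwo
import Literature.NumberTheory.ComplexMultiplication.HalfSystemIndexFormula
import HarnessLib

/-!
# Swapping conjugate pairs in a CM type on a finite commutative group: `T^D = (T ∖ D) ∪ ρD`, its character sums
# `Ŝ_{T^D}(χ) = Ŝ_T(χ) − 2 Σ_{d∈D} χ(d)` (`χ` odd); exponent `2`: one swap flips Kubota's parity class, the
# kernel type of an odd character and its swaps (ranks `2`, `|G|/2 + 1`, `|G|/4 + 1`)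

Setting of the tree's `DegenerateCMTypesElementaryAbelianTwoGroup` / `DegenerateCMTypesAbelianStabilizerCharacters`
(seat p10, g37-#3 / g38-#1): `G` a finite commutative group, `ρ ∈ G`, `T ⊆ G` a CM type w.r.t. `ρ` (`T ⊔ ρT = G`,
`IsCMTypeWith ρ T`), `Ŝ_T(χ) = Σ_{t∈T} χ(t)` for a character `χ`, Kubota's formula `rank(T) = 1 + #{χ odd :
Ŝ_T(χ) ≠ 0}` (T. Kubota [Kubota1965] §4 Lemma 2 = B. B. Gordon [Gordon1999HodgeAVSurvey] Prop. 9.4.1), and in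
exponent `2` the sign counts `a_χ(T) = #{t ∈ T : χ(t) = −1}`, `Ŝ_T(χ) = |T| − 2a_χ(T)` (B. Dodson's weights
[Dodson1984] §3.1.1: a type of a CM field with an imaginary quadratic subfield is a vector `f ∈ (ℤ₂)ⁿ`, and the orbit
computations of §3.2 change such vectors coordinate by coordinate).  A CM type contains exactly one element of each
pair `{x, ρx}`; replacing, for the elements `d` of a subset `D ⊆ T`, the chosen `d` by its conjugate `ρd` gives
another CM type, the SWAP `T^D = (T ∖ D) ∪ ρD` of `T` along `D`, and every CM type `T'` (same `ρ`) is `T^D` for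
`D = T ∖ T'`.  In the Boolean dictionary of the tree's order-`32` file (`…ElementaryAbelianOrderThirtyTwo`: types on
`⟨ρ⟩ × 𝔽₂ⁿ` are the Boolean functions of `n` variables, Kubota's survivors their Walsh supports, C. Carlet
[Carlet2020] §2.3) a swap along `D` changes the truth table at the points of `D`.

THIS FILE records the (elementary) effect of swaps on the character sums and, in exponent `2`, on Kubota's rank:

* §1 (every finite commutative `G`) `mem_sdiff_union_image_iff`, **`isCMTypeWith_sdiff_union_image`** (`T^D` is a
  CM type), `card_sdiff_union_image`, **`sum_char_sdiff_union_image`** (`Ŝ_{T^D}(χ) = Ŝ_T(χ) + (χ(ρ) − 1)Σ_D χ`;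
  odd `χ`: `Ŝ_T(χ) − 2Σ_D χ`; even `χ`: unchanged), **`sdiff_union_image_sdiff_eq`** (every CM type `T'` is
  `T^{T ∖ T'}`), `sum_char_eq_sub_two_mul_sum_sdiff` (`Ŝ_{T'}(χ) = Ŝ_T(χ) − 2Σ_{T∖T'} χ` for odd `χ`); the single
  swap `T^t = insert (ρt) (T.erase t)` (a CM type by the tree's `HalfSystemIndex.isCMTypeWith_swap`, Schmidt
  1984 Kap. III §1; here `sum_char_insert_erase_of_odd`: `Ŝ_{T^t}(χ) = Ŝ_T(χ) − 2χ(t)`) and the swap of a pair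
  (`isCMTypeWith_pair_swap`, `sum_char_pair_swap_of_odd`).
* §2 (exponent `2`) `sum_char_pair_swap_eq` (`Ŝ_{T^{t₁,t₂}}(χ) = Ŝ_T(χ) − 2χ(t₁)(1 + χ(t₁t₂))`: a pair swap moves
  `Ŝ(χ)` by `∓4` if `χ(t₁t₂) = 1` and not at all if `χ(t₁t₂) = −1`), `sum_char_pair_swap_ne_zero_iff_of_eq_zero`
  (a vanishing odd `χ` survives the pair swap iff `χ(t₁t₂) = 1`), `sum_char_pair_swap_ne_zero_of_lt` (a survivor
  with `|Ŝ(χ)| > 4` stays one); `card_filter_insert_erase_of_eq_one/neg_one` (`a_χ(T^t) = a_χ(T) ± 1`),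
  **`even_card_filter_insert_erase_iff`** (ONE SWAP FLIPS THE COMMON PARITY of the sign counts),
  **`typeRank_insert_erase_eq_of_even`** / **`typeRank_insert_erase_eq_of_typeRank_ne`** (`8 ∣ |G|`: a single swap
  of an even — in particular of any DEGENERATE — type is NONDEGENERATE: every degenerate CM type of a multiquadratic
  CM field is one conjugate pair away from a nondegenerate one).
* §3 (exponent `2`) the KERNEL TYPE `T_{χ₁} = {g : χ₁(g) = 1}` of an odd character: `isCMTypeWith_filter_eq_one`,
  `typeRank_filter_eq_one_eq_two` (rank `2`), `typeRank_insert_erase_filter_eq_one` (one swap: rank `|G|/2 + 1`,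
  `8 ∣ |G|`), **`typeRank_pair_swap_filter_eq_one`** (two swaps: rank `|G|/4 + 1`, `|G| ≠ 8`, by the tree's
  weight-two theorem `typeRank_eq_of_card_filter_eq_two`); existence corollaries
  `exists_isCMTypeWith_typeRank_eq_two` (`ρ ≠ 1`), `exists_isCMTypeWith_typeRank_eq_card_div_four_add_one`
  (`|G| ≥ 16`).  (Existence of the full rank `|G|/2 + 1` is the tree's `NondegenerateCMTypeExistenceAbelian`,
  not restated.)

HONEST SCOPE.  Elementary regrouping on Kubota's character formula; the sources print the formula (Kubota, Gordon),
the weight vectors and their coordinatewise manipulation (Dodson §3.1–3.2) and the Walsh calculus (Carlet §2.3);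
the swap bookkeeping is this file's.  The sequels use it for the majority type of three odd characters and the
existence half of the order-`32` rank spectrum.  THEOREMS ONLY: no definition, no named fact, no instance, no
`sorry`.

## References

* [Kubota1965] T. Kubota, *On the field extension by complex multiplication*, Trans. AMS 118 (1965), §2, §4 Lemma 2.
* [Gordon1999HodgeAVSurvey] B. B. Gordon, *A survey of the Hodge conjecture for abelian varieties*, Prop. 9.4.1.
* [Dodson1984] B. Dodson, *The structure of Galois groups of CM-fields*, Trans. AMS 283 (1984), §3.1.1 Theorem
  (constant weight criterion), §3.2.1 (orbit of a weight vector `f`), held text pp. 11–13.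
* [Carlet2020] C. Carlet, *Boolean Functions for Cryptography and Coding Theory*, CUP, §2.3 (Walsh transform,
  (2.47) Parseval, p. 61).

## Provenance

Lane `lit-hodgefound` (Track 2, Layer A3), seat `lit-hodgefound-p10` generation 39, row g39-#1; neighbours cited
by name, nothing restated: `DegenerateCMTypesElementaryAbelianTwoGroup` (`sum_char_eq_card_sub_two_mul`,
`two_mul_card_filter_univ_eq`, `typeRank_eq_two_iff`, `typeRank_eq_of_odd`, `even_card_filter_of_typeRank_ne`),
`DegenerateCMTypesElementaryAbelianWeightTwo` (`typeRank_eq_of_card_filter_eq_two`), `HalfSystemIndexFormula`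
(`HalfSystemIndex.isCMTypeWith_swap`: the single swap of a half-system is a half-system, Schmidt 1984),
`CMTypeElementaryTwoGroupOddWeights` (`character_apply_eq_one_or_of_mul_self`), Mathlib `AddChar.exists_apply_ne_zero`.
-/

open scoped BigOperators Classical

namespace Literature.NumberTheory.ComplexMultiplication

namespace CyclicCMType

/-! ## §1 Swaps along a subset (every finite commutative group) -/

namespace AbelianSwap

variable {G : Type*} [CommGroup G] [Fintype G] [DecidableEq G] {ρ : G} {T : Finset G}

section Helpers

omit [Fintype G] [DecidableEq G] in
/-- `ρ² = 1` for the conjugation of a CM type. [folklore] -/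
private theorem rho_mul_rho_sw (h : IsCMTypeWith ρ (T : Set G)) : ρ * ρ = 1 := by
  have := h.invol (1 : G)
  simpa [smul_eq_mul] using this

omit [Fintype G] [DecidableEq G] in
/-- `ρx ∈ T ⟺ x ∉ T`. [folklore] -/
private theorem rho_mul_mem_iff_sw (h : IsCMTypeWith ρ (T : Set G)) (x : G) : ρ * x ∈ T ↔ x ∉ T := by
  have := h.rho_smul_mem_iff x
  simpa only [smul_eq_mul, Finset.mem_coe] using this

omit [Fintype G] [DecidableEq G] in
/-- `χ(gh) = χ(g)χ(h)`. [folklore] -/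
private theorem char_mul_sw (χ : AddChar (Additive G) ℂ) (g h : G) :
    χ (Additive.ofMul (g * h)) = χ (Additive.ofMul g) * χ (Additive.ofMul h) := by
  rw [ofMul_mul, AddChar.map_add_eq_mul]

omit [Fintype G] in
/-- `x ∈ ρD ⟺ ρx ∈ D` (`ρ² = 1`). [folklore] -/
private theorem mem_image_rho_mul_iff (hρ2 : ρ * ρ = 1) (D : Finset G) (x : G) :
    x ∈ D.image (fun d => ρ * d) ↔ ρ * x ∈ D := by
  rw [Finset.mem_image]
  constructor
  · rintro ⟨d, hd, rfl⟩
    rwa [← mul_assoc, hρ2, one_mul]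
  · intro hx
    exact ⟨ρ * x, hx, by rw [← mul_assoc, hρ2, one_mul]⟩

omit [Fintype G] in
/-- `T ∖ D` and `ρD` are disjoint for `D ⊆ T` (`ρT ∩ T = ∅`). [folklore] -/
private theorem disjoint_sdiff_image (h : IsCMTypeWith ρ (T : Set G)) {D : Finset G} (hD : D ⊆ T) :
    Disjoint (T \ D) (D.image fun d => ρ * d) := by
  rw [Finset.disjoint_left]
  intro x hx hx'
  rw [mem_image_rho_mul_iff (rho_mul_rho_sw h)] at hx'
  exact (rho_mul_mem_iff_sw h x).1 (hD hx') (Finset.mem_sdiff.1 hx).1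

end Helpers

section Swap

omit [Fintype G] in
/-- Membership in the swap `T^D = (T ∖ D) ∪ ρD`: `x ∈ T^D ⟺ (x ∈ T ∖ D) ∨ ρx ∈ D`. [cite: Dodson1984, §3.2.1 (proof)] -/
theorem mem_sdiff_union_image_iff (hρ2 : ρ * ρ = 1) {D : Finset G} (x : G) :
    x ∈ (T \ D) ∪ D.image (fun d => ρ * d) ↔ (x ∈ T ∧ x ∉ D) ∨ ρ * x ∈ D := by
  rw [Finset.mem_union, Finset.mem_sdiff, mem_image_rho_mul_iff hρ2]

omit [Fintype G] in
/-- **THE SWAP OF A CM TYPE ALONG `D ⊆ T` IS A CM TYPE**: `T^D = (T ∖ D) ∪ ρD` again contains exactly one element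
of each conjugate pair `{x, ρx}` ("every embedding is among `{φ₁, φ̄₁, …, φₙ, φ̄ₙ}`": exchange `φⱼ ↔ φ̄ⱼ` for the
`j` in `D`). [cite: Dodson1984, §3.1.1 Theorem (proof)] [cite: Kubota1965, §2] -/
theorem isCMTypeWith_sdiff_union_image (h : IsCMTypeWith ρ (T : Set G)) {D : Finset G} (hD : D ⊆ T) :
    IsCMTypeWith ρ (((T \ D) ∪ D.image (fun d => ρ * d) : Finset G) : Set G) := by
  have hρ2 := rho_mul_rho_sw h
  refine ⟨fun x => ?_, h.comm, h.invol⟩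
  simp only [Finset.mem_coe, smul_eq_mul]
  rw [mem_sdiff_union_image_iff hρ2, mem_sdiff_union_image_iff hρ2, ← mul_assoc, hρ2, one_mul]
  have h1 : ρ * x ∈ T ↔ x ∉ T := rho_mul_mem_iff_sw h x
  have h2 : ρ * x ∈ D → x ∉ T := fun hx => h1.1 (hD hx)
  have h3 : x ∈ D → ρ * x ∉ D := fun hx hρx => (h1.1 (hD hρx)) (hD hx)
  tauto

omit [Fintype G] in
/-- **A swap keeps the size**: `|T^D| = |T|`. [cite: Kubota1965, §2] -/
theorem card_sdiff_union_image (h : IsCMTypeWith ρ (T : Set G)) {D : Finset G} (hD : D ⊆ T) :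
    ((T \ D) ∪ D.image (fun d => ρ * d)).card = T.card := by
  have hinj : Function.Injective (fun d : G => ρ * d) := fun a b hab => mul_left_cancel hab
  rw [Finset.card_union_of_disjoint (disjoint_sdiff_image h hD), Finset.card_sdiff_of_subset hD,
    Finset.card_image_of_injective _ hinj]
  have := Finset.card_le_card hD
  omega

omit [Fintype G] in
/-- **CHARACTER SUMS OF A SWAP**: `Ŝ_{T^D}(χ) = Ŝ_T(χ) + (χ(ρ) − 1)·Σ_{d∈D} χ(d)` for every character `χ`
(`χ(ρd) = χ(ρ)χ(d)`). [cite: Kubota1965, §4 Lemma 2 (proof)] -/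
theorem sum_char_sdiff_union_image (h : IsCMTypeWith ρ (T : Set G)) {D : Finset G} (hD : D ⊆ T)
    (χ : AddChar (Additive G) ℂ) :
    ∑ s ∈ (T \ D) ∪ D.image (fun d => ρ * d), χ (Additive.ofMul s) =
      ∑ s ∈ T, χ (Additive.ofMul s) + (χ (Additive.ofMul ρ) - 1) * ∑ d ∈ D, χ (Additive.ofMul d) := by
  have hinj : Function.Injective (fun d : G => ρ * d) := fun a b hab => mul_left_cancel hab
  rw [Finset.sum_union (disjoint_sdiff_image h hD), Finset.sum_image fun a _ b _ hab => hinj hab,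
    ← Finset.sum_sdiff hD]
  simp only [char_mul_sw, ← Finset.mul_sum]
  ring

omit [Fintype G] in
/-- **Odd characters**: `Ŝ_{T^D}(χ) = Ŝ_T(χ) − 2·Σ_{d∈D} χ(d)` for `χ(ρ) = −1`. [cite: Kubota1965, §4 Lemma 2 (proof)] -/
theorem sum_char_sdiff_union_image_of_odd (h : IsCMTypeWith ρ (T : Set G)) {D : Finset G} (hD : D ⊆ T)
    {χ : AddChar (Additive G) ℂ} (hχ : χ (Additive.ofMul ρ) = -1) :
    ∑ s ∈ (T \ D) ∪ D.image (fun d => ρ * d), χ (Additive.ofMul s) =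
      ∑ s ∈ T, χ (Additive.ofMul s) - 2 * ∑ d ∈ D, χ (Additive.ofMul d) := by
  rw [sum_char_sdiff_union_image h hD χ, hχ]
  ring

omit [Fintype G] in
/-- **Even characters do not see swaps**: `Ŝ_{T^D}(χ) = Ŝ_T(χ)` for `χ(ρ) = 1`. [cite: Kubota1965, §4 Lemma 2 (proof)] -/
theorem sum_char_sdiff_union_image_of_even (h : IsCMTypeWith ρ (T : Set G)) {D : Finset G} (hD : D ⊆ T)
    {χ : AddChar (Additive G) ℂ} (hχ : χ (Additive.ofMul ρ) = 1) :
    ∑ s ∈ (T \ D) ∪ D.image (fun d => ρ * d), χ (Additive.ofMul s) = ∑ s ∈ T, χ (Additive.ofMul s) := by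
  rw [sum_char_sdiff_union_image h hD χ, hχ]
  ring

omit [Fintype G] in
/-- **ANY TWO CM TYPES FOR THE SAME `ρ` DIFFER BY A SWAP**: `T' = T^{T ∖ T'} = (T ∩ T') ∪ ρ(T ∖ T')`.
[cite: Dodson1984, §3.1.1 Theorem (proof)] [cite: Kubota1965, §2] -/
theorem sdiff_union_image_sdiff_eq (h : IsCMTypeWith ρ (T : Set G)) {T' : Finset G}
    (h' : IsCMTypeWith ρ (T' : Set G)) :
    (T \ (T \ T')) ∪ (T \ T').image (fun d => ρ * d) = T' := by
  have hρ2 := rho_mul_rho_sw h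
  ext x
  rw [mem_sdiff_union_image_iff hρ2, Finset.mem_sdiff, Finset.mem_sdiff]
  have h1 := rho_mul_mem_iff_sw h x
  have h2 := rho_mul_mem_iff_sw h' x
  tauto

omit [Fintype G] in
/-- **The character sums of two CM types differ by twice a sum over their difference**: `Ŝ_{T'}(χ) = Ŝ_T(χ) −
2·Σ_{d ∈ T∖T'} χ(d)` for every odd `χ`. [cite: Kubota1965, §4 Lemma 2 (proof)] -/
theorem sum_char_eq_sub_two_mul_sum_sdiff (h : IsCMTypeWith ρ (T : Set G)) {T' : Finset G}
    (h' : IsCMTypeWith ρ (T' : Set G)) {χ : AddChar (Additive G) ℂ} (hχ : χ (Additive.ofMul ρ) = -1) :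
    ∑ s ∈ T', χ (Additive.ofMul s) =
      ∑ s ∈ T, χ (Additive.ofMul s) - 2 * ∑ d ∈ T \ T', χ (Additive.ofMul d) := by
  conv_lhs => rw [← sdiff_union_image_sdiff_eq h h']
  exact sum_char_sdiff_union_image_of_odd h Finset.sdiff_subset hχ

end Swap

/-! ### The single swap `T^t = (T ∖ {t}) ∪ {ρt}` and the swap of a pair -/

section Single

omit [Fintype G] in
/-- `(T ∖ {t}) ∪ ρ{t} = insert (ρt) (T.erase t)`. [folklore] -/
private theorem sdiff_singleton_union_image_eq (t : G) :
    (T \ {t}) ∪ ({t} : Finset G).image (fun d => ρ * d) = insert (ρ * t) (T.erase t) := by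
  rw [Finset.image_singleton, Finset.sdiff_singleton_eq_erase, Finset.union_comm, ← Finset.insert_eq]

omit [Fintype G] in
/-- `|T^t| = |T|`. [cite: Kubota1965, §2] -/
theorem card_insert_erase_eq (h : IsCMTypeWith ρ (T : Set G)) {t : G} (ht : t ∈ T) :
    (insert (ρ * t) (T.erase t)).card = T.card := by
  rw [← sdiff_singleton_union_image_eq]
  exact card_sdiff_union_image h (Finset.singleton_subset_iff.2 ht)

omit [Fintype G] in
/-- **`Ŝ_{T^t}(χ) = Ŝ_T(χ) − 2χ(t)`** for odd `χ`. [cite: Kubota1965, §4 Lemma 2 (proof)] -/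
theorem sum_char_insert_erase_of_odd (h : IsCMTypeWith ρ (T : Set G)) {t : G} (ht : t ∈ T)
    {χ : AddChar (Additive G) ℂ} (hχ : χ (Additive.ofMul ρ) = -1) :
    ∑ s ∈ insert (ρ * t) (T.erase t), χ (Additive.ofMul s) =
      ∑ s ∈ T, χ (Additive.ofMul s) - 2 * χ (Additive.ofMul t) := by
  rw [← sdiff_singleton_union_image_eq, sum_char_sdiff_union_image_of_odd h (Finset.singleton_subset_iff.2 ht) hχ,
    Finset.sum_singleton]

omit [CommGroup G] [Fintype G] in
/-- `{t₁, t₂} ⊆ T` for `t₁, t₂ ∈ T`. [folklore] -/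
private theorem pair_subset {t₁ t₂ : G} (h₁ : t₁ ∈ T) (h₂ : t₂ ∈ T) : ({t₁, t₂} : Finset G) ⊆ T :=
  Finset.insert_subset h₁ (Finset.singleton_subset_iff.2 h₂)

omit [Fintype G] in
/-- **The swap of a pair**: `T^{t₁,t₂}` (`t₁ ≠ t₂` in `T`) is a CM type. [cite: Dodson1984, §3.1.1 Theorem (proof)] -/
theorem isCMTypeWith_pair_swap (h : IsCMTypeWith ρ (T : Set G)) {t₁ t₂ : G} (h₁ : t₁ ∈ T) (h₂ : t₂ ∈ T) :
    IsCMTypeWith ρ (((T \ {t₁, t₂}) ∪ ({t₁, t₂} : Finset G).image (fun d => ρ * d) : Finset G) : Set G) :=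
  isCMTypeWith_sdiff_union_image h (pair_subset h₁ h₂)

omit [Fintype G] in
/-- `|T^{t₁,t₂}| = |T|`. [cite: Kubota1965, §2] -/
theorem card_pair_swap (h : IsCMTypeWith ρ (T : Set G)) {t₁ t₂ : G} (h₁ : t₁ ∈ T) (h₂ : t₂ ∈ T) :
    ((T \ {t₁, t₂}) ∪ ({t₁, t₂} : Finset G).image (fun d => ρ * d)).card = T.card :=
  card_sdiff_union_image h (pair_subset h₁ h₂)

omit [Fintype G] in
/-- **`Ŝ_{T^{t₁,t₂}}(χ) = Ŝ_T(χ) − 2(χ(t₁) + χ(t₂))`** for odd `χ` and `t₁ ≠ t₂` in `T`. [cite: Kubota1965, §4 Lemma 2 (proof)] -/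
theorem sum_char_pair_swap_of_odd (h : IsCMTypeWith ρ (T : Set G)) {t₁ t₂ : G} (h₁ : t₁ ∈ T) (h₂ : t₂ ∈ T)
    (hne : t₁ ≠ t₂) {χ : AddChar (Additive G) ℂ} (hχ : χ (Additive.ofMul ρ) = -1) :
    ∑ s ∈ (T \ {t₁, t₂}) ∪ ({t₁, t₂} : Finset G).image (fun d => ρ * d), χ (Additive.ofMul s) =
      ∑ s ∈ T, χ (Additive.ofMul s) - 2 * (χ (Additive.ofMul t₁) + χ (Additive.ofMul t₂)) := by
  rw [sum_char_sdiff_union_image_of_odd h (pair_subset h₁ h₂) hχ, Finset.sum_pair hne]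

end Single

end AbelianSwap

/-! ## §2 Exponent `2`: pair swaps, sign counts and the parity flip -/

namespace ExponentTwo

variable {G : Type*} [CommGroup G] [Fintype G] [DecidableEq G] {ρ : G} {T : Finset G}

section HelpersTwo

omit [Fintype G] [DecidableEq G] in
/-- `g·g = 1` in exponent `2`. [folklore] -/
private theorem mul_self_eq_one_sw2 (hexp : ∀ g : G, g ^ 2 = 1) (g : G) : g * g = 1 := by
  rw [← pow_two]; exact hexp g

omit [Fintype G] [DecidableEq G] in
/-- Characters of a group of exponent `2` are `±1`-valued. [cite: Kubota1965, §4 Lemma 2 (proof)] -/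
private theorem char_eq_one_or_sw2 (hexp : ∀ g : G, g ^ 2 = 1) (χ : AddChar (Additive G) ℂ) (g : G) :
    χ (Additive.ofMul g) = 1 ∨ χ (Additive.ofMul g) = -1 :=
  character_apply_eq_one_or_of_mul_self χ (mul_self_eq_one_sw2 hexp g)

omit [Fintype G] [DecidableEq G] in
/-- `χ(gh) = χ(g)χ(h)`. [folklore] -/
private theorem char_mul_sw2 (χ : AddChar (Additive G) ℂ) (g h : G) :
    χ (Additive.ofMul (g * h)) = χ (Additive.ofMul g) * χ (Additive.ofMul h) := by
  rw [ofMul_mul, AddChar.map_add_eq_mul]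

omit [Fintype G] [DecidableEq G] in
/-- `ρ² = 1` for the conjugation of a CM type. [folklore] -/
private theorem rho_mul_rho_sw2 (h : IsCMTypeWith ρ (T : Set G)) : ρ * ρ = 1 := by
  have := h.invol (1 : G)
  simpa [smul_eq_mul] using this

omit [Fintype G] [DecidableEq G] in
/-- `ρ ≠ 1`. [folklore] -/
private theorem rho_ne_one_sw2 (h : IsCMTypeWith ρ (T : Set G)) : ρ ≠ 1 := by
  intro hρ
  have := h.rho_smul_ne (1 : G)
  rw [hρ, smul_eq_mul, one_mul] at this
  exact this rfl

omit [DecidableEq G] in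
/-- An odd character exists for an involution `ρ ≠ 1`. [cite: Kubota1965, §4 Lemma 2 (proof)] -/
private theorem exists_odd_sw2 (hρ1 : ρ ≠ 1) (hρ2 : ρ * ρ = 1) :
    ∃ χ : AddChar (Additive G) ℂ, χ (Additive.ofMul ρ) = -1 := by
  have hρ0 : (Additive.ofMul ρ : Additive G) ≠ 0 := by
    intro h0
    exact hρ1 (by simpa using congrArg Additive.toMul h0)
  obtain ⟨χ, hχ⟩ := (AddChar.exists_apply_ne_zero (α := Additive G)).2 hρ0
  exact ⟨χ, (character_apply_eq_one_or_of_mul_self χ hρ2).resolve_left hχ⟩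

omit [Fintype G] [DecidableEq G] in
/-- In exponent `2`: `χ(t₁) + χ(t₂) = χ(t₁)(1 + χ(t₁t₂))`. [cite: Kubota1965, §4 Lemma 2 (proof)] -/
private theorem add_eq_mul_one_add (hexp : ∀ g : G, g ^ 2 = 1) (χ : AddChar (Additive G) ℂ) (t₁ t₂ : G) :
    χ (Additive.ofMul t₁) + χ (Additive.ofMul t₂) =
      χ (Additive.ofMul t₁) * (1 + χ (Additive.ofMul (t₁ * t₂))) := by
  rw [char_mul_sw2]
  rcases char_eq_one_or_sw2 hexp χ t₁ with h1 | h1 <;> rw [h1] <;> ring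

end HelpersTwo

section PairSwap

omit [Fintype G] in
/-- **PAIR SWAPS IN EXPONENT `2`**: `Ŝ_{T^{t₁,t₂}}(χ) = Ŝ_T(χ) − 2χ(t₁)(1 + χ(t₁t₂))` for odd `χ` — the swap of the
pair `{t₁, t₂}` moves `Ŝ(χ)` by `∓4` when `χ(t₁t₂) = 1` and leaves it unchanged when `χ(t₁t₂) = −1`.
[cite: Kubota1965, §4 Lemma 2 (proof)] [cite: Dodson1984, §3.1.1 Theorem] -/
theorem sum_char_pair_swap_eq (hexp : ∀ g : G, g ^ 2 = 1) (h : IsCMTypeWith ρ (T : Set G)) {t₁ t₂ : G}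
    (h₁ : t₁ ∈ T) (h₂ : t₂ ∈ T) (hne : t₁ ≠ t₂) {χ : AddChar (Additive G) ℂ} (hχ : χ (Additive.ofMul ρ) = -1) :
    ∑ s ∈ (T \ {t₁, t₂}) ∪ ({t₁, t₂} : Finset G).image (fun d => ρ * d), χ (Additive.ofMul s) =
      ∑ s ∈ T, χ (Additive.ofMul s) - 2 * (χ (Additive.ofMul t₁) * (1 + χ (Additive.ofMul (t₁ * t₂)))) := by
  rw [AbelianSwap.sum_char_pair_swap_of_odd h h₁ h₂ hne hχ, add_eq_mul_one_add hexp]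

omit [Fintype G] in
/-- `χ(t₁t₂) = −1` ⟹ `Ŝ_{T^{t₁,t₂}}(χ) = Ŝ_T(χ)`. [cite: Kubota1965, §4 Lemma 2 (proof)] -/
theorem sum_char_pair_swap_eq_self (hexp : ∀ g : G, g ^ 2 = 1) (h : IsCMTypeWith ρ (T : Set G)) {t₁ t₂ : G}
    (h₁ : t₁ ∈ T) (h₂ : t₂ ∈ T) (hne : t₁ ≠ t₂) {χ : AddChar (Additive G) ℂ} (hχ : χ (Additive.ofMul ρ) = -1)
    (hg : χ (Additive.ofMul (t₁ * t₂)) = -1) :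
    ∑ s ∈ (T \ {t₁, t₂}) ∪ ({t₁, t₂} : Finset G).image (fun d => ρ * d), χ (Additive.ofMul s) =
      ∑ s ∈ T, χ (Additive.ofMul s) := by
  rw [sum_char_pair_swap_eq hexp h h₁ h₂ hne hχ, hg]
  ring

omit [Fintype G] in
/-- `χ(t₁t₂) = 1` ⟹ `Ŝ_{T^{t₁,t₂}}(χ) = Ŝ_T(χ) − 4χ(t₁)`. [cite: Kubota1965, §4 Lemma 2 (proof)] -/
theorem sum_char_pair_swap_eq_sub (hexp : ∀ g : G, g ^ 2 = 1) (h : IsCMTypeWith ρ (T : Set G)) {t₁ t₂ : G}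
    (h₁ : t₁ ∈ T) (h₂ : t₂ ∈ T) (hne : t₁ ≠ t₂) {χ : AddChar (Additive G) ℂ} (hχ : χ (Additive.ofMul ρ) = -1)
    (hg : χ (Additive.ofMul (t₁ * t₂)) = 1) :
    ∑ s ∈ (T \ {t₁, t₂}) ∪ ({t₁, t₂} : Finset G).image (fun d => ρ * d), χ (Additive.ofMul s) =
      ∑ s ∈ T, χ (Additive.ofMul s) - 4 * χ (Additive.ofMul t₁) := by
  rw [sum_char_pair_swap_eq hexp h h₁ h₂ hne hχ, hg]
  ring

omit [Fintype G] in
/-- **A VANISHING odd character becomes a survivor of the pair swap iff `χ(t₁t₂) = 1`**: if `Ŝ_T(χ) = 0` then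
`Ŝ_{T^{t₁,t₂}}(χ) ≠ 0 ⟺ χ(t₁t₂) = 1`. [cite: Kubota1965, §4 Lemma 2] [cite: Dodson1984, §3.1.1 Theorem] -/
theorem sum_char_pair_swap_ne_zero_iff_of_eq_zero (hexp : ∀ g : G, g ^ 2 = 1) (h : IsCMTypeWith ρ (T : Set G))
    {t₁ t₂ : G} (h₁ : t₁ ∈ T) (h₂ : t₂ ∈ T) (hne : t₁ ≠ t₂) {χ : AddChar (Additive G) ℂ}
    (hχ : χ (Additive.ofMul ρ) = -1) (h0 : ∑ s ∈ T, χ (Additive.ofMul s) = 0) :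
    ∑ s ∈ (T \ {t₁, t₂}) ∪ ({t₁, t₂} : Finset G).image (fun d => ρ * d), χ (Additive.ofMul s) ≠ 0 ↔
      χ (Additive.ofMul (t₁ * t₂)) = 1 := by
  rw [sum_char_pair_swap_eq hexp h h₁ h₂ hne hχ, h0, zero_sub, neg_ne_zero]
  rcases char_eq_one_or_sw2 hexp χ t₁ with e1 | e1 <;>
    rcases char_eq_one_or_sw2 hexp χ (t₁ * t₂) with eg | eg <;> rw [e1, eg] <;> norm_num

omit [Fintype G] in
/-- **A survivor with `|Ŝ_T(χ)| > 4` survives every pair swap**: in sign-count terms, if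
`2a_χ(T) + 4 < |T|` or `|T| + 4 < 2a_χ(T)` then `Ŝ_{T^{t₁,t₂}}(χ) ≠ 0` (`Ŝ = |T| − 2a` moves by at most `4`).
[cite: Kubota1965, §4 Lemma 2] [cite: Dodson1984, §3.1.1 Theorem] -/
theorem sum_char_pair_swap_ne_zero_of_lt (hexp : ∀ g : G, g ^ 2 = 1) (h : IsCMTypeWith ρ (T : Set G))
    {t₁ t₂ : G} (h₁ : t₁ ∈ T) (h₂ : t₂ ∈ T) (hne : t₁ ≠ t₂) {χ : AddChar (Additive G) ℂ}
    (hχ : χ (Additive.ofMul ρ) = -1)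
    (ha : 2 * (T.filter fun s => χ (Additive.ofMul s) = -1).card + 4 < T.card ∨
      T.card + 4 < 2 * (T.filter fun s => χ (Additive.ofMul s) = -1).card) :
    ∑ s ∈ (T \ {t₁, t₂}) ∪ ({t₁, t₂} : Finset G).image (fun d => ρ * d), χ (Additive.ofMul s) ≠ 0 := by
  rw [sum_char_pair_swap_eq hexp h h₁ h₂ hne hχ, sum_char_eq_card_sub_two_mul hexp χ T]
  set a := (T.filter fun s => χ (Additive.ofMul s) = -1).card with ha_def
  intro h0
  rcases char_eq_one_or_sw2 hexp χ t₁ with e1 | e1 <;>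
    rcases char_eq_one_or_sw2 hexp χ (t₁ * t₂) with eg | eg <;> rw [e1, eg] at h0
  · have hc : ((T.card : ℕ) : ℂ) = ((2 * a + 4 : ℕ) : ℂ) := by push_cast; linear_combination h0
    have := Nat.cast_injective hc
    omega
  · have hc : ((T.card : ℕ) : ℂ) = ((2 * a : ℕ) : ℂ) := by push_cast; linear_combination h0
    have := Nat.cast_injective hc
    omega
  · have hc : ((T.card + 4 : ℕ) : ℂ) = ((2 * a : ℕ) : ℂ) := by push_cast; linear_combination h0
    have := Nat.cast_injective hc
    omega
  · have hc : ((T.card : ℕ) : ℂ) = ((2 * a : ℕ) : ℂ) := by push_cast; linear_combination h0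
    have := Nat.cast_injective hc
    omega

end PairSwap

section SingleSwap

omit [Fintype G] in
/-- **Sign count after a single swap at `t` with `χ(t) = 1`** (odd `χ`): `a_χ(T^t) = a_χ(T) + 1` (a `+1` is traded
for the `−1` at `ρt`). [cite: Dodson1984, §3.1.1 Theorem] [cite: Kubota1965, §4 Lemma 2 (proof)] -/
theorem card_filter_insert_erase_of_eq_one (hexp : ∀ g : G, g ^ 2 = 1) (h : IsCMTypeWith ρ (T : Set G))
    {t : G} (ht : t ∈ T) {χ : AddChar (Additive G) ℂ} (hχ : χ (Additive.ofMul ρ) = -1)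
    (hχt : χ (Additive.ofMul t) = 1) :
    ((insert (ρ * t) (T.erase t)).filter fun s => χ (Additive.ofMul s) = -1).card =
      (T.filter fun s => χ (Additive.ofMul s) = -1).card + 1 := by
  have hS := AbelianSwap.sum_char_insert_erase_of_odd h ht hχ
  rw [sum_char_eq_card_sub_two_mul hexp χ, sum_char_eq_card_sub_two_mul hexp χ T,
    AbelianSwap.card_insert_erase_eq h ht, hχt] at hS
  set a' := ((insert (ρ * t) (T.erase t)).filter fun s => χ (Additive.ofMul s) = -1).card
  set a := (T.filter fun s => χ (Additive.ofMul s) = -1).card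
  have hc : ((a' : ℕ) : ℂ) = ((a + 1 : ℕ) : ℂ) := by push_cast; linear_combination (-1 / 2 : ℂ) * hS
  exact Nat.cast_injective hc

omit [Fintype G] in
/-- **Sign count after a single swap at `t` with `χ(t) = −1`** (odd `χ`): `a_χ(T^t) + 1 = a_χ(T)`.
[cite: Dodson1984, §3.1.1 Theorem] [cite: Kubota1965, §4 Lemma 2 (proof)] -/
theorem card_filter_insert_erase_of_eq_neg_one (hexp : ∀ g : G, g ^ 2 = 1) (h : IsCMTypeWith ρ (T : Set G))
    {t : G} (ht : t ∈ T) {χ : AddChar (Additive G) ℂ} (hχ : χ (Additive.ofMul ρ) = -1)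
    (hχt : χ (Additive.ofMul t) = -1) :
    ((insert (ρ * t) (T.erase t)).filter fun s => χ (Additive.ofMul s) = -1).card + 1 =
      (T.filter fun s => χ (Additive.ofMul s) = -1).card := by
  have hS := AbelianSwap.sum_char_insert_erase_of_odd h ht hχ
  rw [sum_char_eq_card_sub_two_mul hexp χ, sum_char_eq_card_sub_two_mul hexp χ T,
    AbelianSwap.card_insert_erase_eq h ht, hχt] at hS
  set a' := ((insert (ρ * t) (T.erase t)).filter fun s => χ (Additive.ofMul s) = -1).card
  set a := (T.filter fun s => χ (Additive.ofMul s) = -1).card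
  have hc : ((a' + 1 : ℕ) : ℂ) = ((a : ℕ) : ℂ) := by push_cast; linear_combination (-1 / 2 : ℂ) * hS
  exact Nat.cast_injective hc

omit [Fintype G] in
/-- **ONE SWAP FLIPS THE PARITY CLASS**: for every odd `χ`, `a_χ(T^t)` is even iff `a_χ(T)` is odd — with the tree's
`card_filter_mod_two_eq` (all `a_χ(T)`, `χ` odd, share one parity when `8 ∣ |G|`) the CM types of a multiquadratic
field split into EVEN and ODD types, and every single swap crosses between the two classes.
[cite: Dodson1984, §3.1.1 Theorem] [cite: Kubota1965, §4 Lemma 2] -/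
theorem even_card_filter_insert_erase_iff (hexp : ∀ g : G, g ^ 2 = 1) (h : IsCMTypeWith ρ (T : Set G))
    {t : G} (ht : t ∈ T) {χ : AddChar (Additive G) ℂ} (hχ : χ (Additive.ofMul ρ) = -1) :
    Even ((insert (ρ * t) (T.erase t)).filter fun s => χ (Additive.ofMul s) = -1).card ↔
      ¬ Even (T.filter fun s => χ (Additive.ofMul s) = -1).card := by
  rcases char_eq_one_or_sw2 hexp χ t with e | e
  · rw [card_filter_insert_erase_of_eq_one hexp h ht hχ e, Nat.even_add_one]
  · rw [← card_filter_insert_erase_of_eq_neg_one hexp h ht hχ e, Nat.even_add_one, not_not]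

/-- **A SINGLE SWAP OF AN EVEN TYPE IS NONDEGENERATE** (`8 ∣ |G|`): if some sign count `a_{χ₀}(T)` (`χ₀` odd) is
even, then for every `t ∈ T` the swapped type `T^t` has full Kubota rank `|G|/2 + 1` (its sign counts are odd, tree
`typeRank_eq_of_odd`). [cite: Kubota1965, §4 Lemma 2] [cite: Dodson1984, §3.1.1 Theorem] -/
theorem typeRank_insert_erase_eq_of_even (hexp : ∀ g : G, g ^ 2 = 1) (h : IsCMTypeWith ρ (T : Set G))
    (h8 : 8 ∣ Fintype.card G) {χ₀ : AddChar (Additive G) ℂ} (hχ₀ : χ₀ (Additive.ofMul ρ) = -1)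
    (heven : Even (T.filter fun s => χ₀ (Additive.ofMul s) = -1).card) {t : G} (ht : t ∈ T) :
    typeRank G ((insert (ρ * t) (T.erase t) : Finset G) : Set G) = Fintype.card G / 2 + 1 :=
  typeRank_eq_of_odd hexp (HalfSystemIndex.isCMTypeWith_swap h ht) h8 hχ₀
    (Nat.not_even_iff_odd.1 fun hev => (even_card_filter_insert_erase_iff hexp h ht hχ₀).1 hev heven)

/-- **EVERY DEGENERATE TYPE IS ONE SWAP AWAY FROM A NONDEGENERATE ONE** (exponent `2`, `8 ∣ |G|`): if
`rank(T) ≠ |G|/2 + 1` then `rank(T^t) = |G|/2 + 1` for every `t ∈ T` (a degenerate type is even, tree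
`even_card_filter_of_typeRank_ne`).  On the field side: changing ONE embedding of a degenerate CM type of a
multiquadratic CM field to its conjugate always produces a nondegenerate type. [cite: Kubota1965, §4 Lemma 2]
[cite: Dodson1984, §3.1.1 Theorem] -/
theorem typeRank_insert_erase_eq_of_typeRank_ne (hexp : ∀ g : G, g ^ 2 = 1) (h : IsCMTypeWith ρ (T : Set G))
    (h8 : 8 ∣ Fintype.card G) (hne : typeRank G (T : Set G) ≠ Fintype.card G / 2 + 1) {t : G} (ht : t ∈ T) :
    typeRank G ((insert (ρ * t) (T.erase t) : Finset G) : Set G) = Fintype.card G / 2 + 1 := by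
  obtain ⟨χ₀, hχ₀⟩ := exists_odd_sw2 (G := G) (rho_ne_one_sw2 h) (rho_mul_rho_sw2 h)
  exact typeRank_insert_erase_eq_of_even hexp h h8 hχ₀ (even_card_filter_of_typeRank_ne hexp h h8 hne hχ₀) ht

end SingleSwap

/-! ## §3 The kernel type `{g : χ₁(g) = 1}` of an odd character and its swaps -/

section KernelType

omit [DecidableEq G] in
/-- **THE KERNEL OF AN ODD CHARACTER IS A CM TYPE** (exponent `2`): `T_{χ₁} = {g : χ₁(g) = 1}` contains exactly one
of `x, ρx` since `χ₁(ρx) = −χ₁(x)` and `χ₁` is `±1`-valued (the index-`2` subgroup `ker χ₁ ∌ ρ`; on the field side the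
type induced from an imaginary quadratic subfield). [cite: Kubota1965, §4 Lemma 2] [cite: Shimura1998, §8.4 Example (2)(A)] -/
theorem isCMTypeWith_filter_eq_one (hexp : ∀ g : G, g ^ 2 = 1) (hρ2 : ρ * ρ = 1) {χ₁ : AddChar (Additive G) ℂ}
    (hχ₁ : χ₁ (Additive.ofMul ρ) = -1) :
    IsCMTypeWith ρ ((Finset.univ.filter fun g : G => χ₁ (Additive.ofMul g) = 1 : Finset G) : Set G) := by
  refine ⟨fun x => ?_, fun g x => ?_, fun x => ?_⟩
  · simp only [Finset.mem_coe, Finset.mem_filter, Finset.mem_univ, true_and, smul_eq_mul, char_mul_sw2, hχ₁]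
    rcases char_eq_one_or_sw2 hexp χ₁ x with e | e <;> rw [e] <;> norm_num
  · simp only [smul_eq_mul]
    rw [mul_left_comm]
  · simp only [smul_eq_mul]
    rw [← mul_assoc, hρ2, one_mul]

omit [DecidableEq G] in
/-- **The kernel type has rank `2`** (`χ₁` is constant on it; tree `typeRank_eq_two_iff`).
[cite: Kubota1965, §4 Lemma 2] [cite: Shimura1998, §8.4 Example (2)(A)] -/
theorem typeRank_filter_eq_one_eq_two (hexp : ∀ g : G, g ^ 2 = 1) (hρ2 : ρ * ρ = 1)
    {χ₁ : AddChar (Additive G) ℂ} (hχ₁ : χ₁ (Additive.ofMul ρ) = -1) :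
    typeRank G ((Finset.univ.filter fun g : G => χ₁ (Additive.ofMul g) = 1 : Finset G) : Set G) = 2 :=
  (typeRank_eq_two_iff hexp (isCMTypeWith_filter_eq_one hexp hρ2 hχ₁)).2
    ⟨χ₁, hχ₁, Or.inl fun _ hs => (Finset.mem_filter.1 hs).2⟩

omit [DecidableEq G] in
/-- `2·|T_{χ₁}| = |G|`. [cite: Kubota1965, §4 Lemma 2 (proof)] -/
theorem two_mul_card_filter_eq_one (hexp : ∀ g : G, g ^ 2 = 1) {χ₁ : AddChar (Additive G) ℂ}
    (hχ₁0 : χ₁ ≠ 0) :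
    2 * (Finset.univ.filter fun g : G => χ₁ (Additive.ofMul g) = 1).card = Fintype.card G := by
  have h1 := two_mul_card_filter_univ_eq hexp hχ₁0
  have h2 := Finset.card_filter_add_card_filter_not (s := (Finset.univ : Finset G))
    (fun g : G => χ₁ (Additive.ofMul g) = -1)
  have h3 : (Finset.univ.filter fun g : G => ¬ χ₁ (Additive.ofMul g) = -1) =
      Finset.univ.filter fun g : G => χ₁ (Additive.ofMul g) = 1 := by
    refine Finset.filter_congr fun g _ => ?_
    rcases char_eq_one_or_sw2 hexp χ₁ g with e | e <;> rw [e] <;> norm_num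
  rw [Finset.card_univ, h3] at h2
  omega

omit [DecidableEq G] in
/-- `a_{χ₁}(T_{χ₁}) = 0`: no element of the kernel type has `χ₁ = −1`. [cite: Dodson1984, §3.1.1 Theorem] -/
theorem card_filter_filter_eq_one_eq_zero (χ₁ : AddChar (Additive G) ℂ) :
    ((Finset.univ.filter fun g : G => χ₁ (Additive.ofMul g) = 1).filter
      fun s => χ₁ (Additive.ofMul s) = -1).card = 0 := by
  rw [Finset.card_eq_zero, Finset.filter_eq_empty_iff]
  intro g hg
  rw [(Finset.mem_filter.1 hg).2]
  norm_num

/-- **ONE SWAP OF THE KERNEL TYPE IS NONDEGENERATE** (`8 ∣ |G|`): `rank(T_{χ₁}^t) = |G|/2 + 1` for every `t` with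
`χ₁(t) = 1`. [cite: Kubota1965, §4 Lemma 2] [cite: Dodson1984, §3.1.1 Theorem] -/
theorem typeRank_insert_erase_filter_eq_one (hexp : ∀ g : G, g ^ 2 = 1) (hρ2 : ρ * ρ = 1)
    (h8 : 8 ∣ Fintype.card G) {χ₁ : AddChar (Additive G) ℂ} (hχ₁ : χ₁ (Additive.ofMul ρ) = -1) {t : G}
    (ht : χ₁ (Additive.ofMul t) = 1) :
    typeRank G ((insert (ρ * t) ((Finset.univ.filter fun g : G => χ₁ (Additive.ofMul g) = 1).erase t) :
      Finset G) : Set G) = Fintype.card G / 2 + 1 :=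
  typeRank_insert_erase_eq_of_even hexp (isCMTypeWith_filter_eq_one hexp hρ2 hχ₁) h8 hχ₁
    (by rw [card_filter_filter_eq_one_eq_zero]; exact Even.zero) (Finset.mem_filter.2 ⟨Finset.mem_univ _, ht⟩)

/-- **TWO SWAPS OF THE KERNEL TYPE GIVE RANK `|G|/4 + 1`** (`|G| ≠ 8`): for `t₁ ≠ t₂` with `χ₁(t₁) = χ₁(t₂) = 1`
the type `T_{χ₁}^{t₁,t₂}` has `a_{χ₁} = 2` (its `χ₁ = −1` part is `{ρt₁, ρt₂}`), hence rank `|G|/4 + 1` by the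
tree's weight-two theorem `typeRank_eq_of_card_filter_eq_two`. [cite: Kubota1965, §4 Lemma 2]
[cite: Dodson1984, §3.1.1 Theorem] -/
theorem typeRank_pair_swap_filter_eq_one (hexp : ∀ g : G, g ^ 2 = 1) (hρ2 : ρ * ρ = 1)
    (h8 : Fintype.card G ≠ 8) {χ₁ : AddChar (Additive G) ℂ} (hχ₁ : χ₁ (Additive.ofMul ρ) = -1) {t₁ t₂ : G}
    (ht₁ : χ₁ (Additive.ofMul t₁) = 1) (ht₂ : χ₁ (Additive.ofMul t₂) = 1) (hne : t₁ ≠ t₂) :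
    typeRank G ((((Finset.univ.filter fun g : G => χ₁ (Additive.ofMul g) = 1) \ {t₁, t₂}) ∪
      ({t₁, t₂} : Finset G).image (fun d => ρ * d) : Finset G) : Set G) = Fintype.card G / 4 + 1 := by
  have hT := isCMTypeWith_filter_eq_one hexp hρ2 hχ₁
  have h₁ : t₁ ∈ Finset.univ.filter fun g : G => χ₁ (Additive.ofMul g) = 1 :=
    Finset.mem_filter.2 ⟨Finset.mem_univ _, ht₁⟩
  have h₂ : t₂ ∈ Finset.univ.filter fun g : G => χ₁ (Additive.ofMul g) = 1 :=
    Finset.mem_filter.2 ⟨Finset.mem_univ _, ht₂⟩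
  have h' := AbelianSwap.isCMTypeWith_pair_swap hT h₁ h₂
  refine typeRank_eq_of_card_filter_eq_two hexp h' h8 hχ₁ ?_
  have e1 : ∀ {t : G} (x : G), ρ * x = t ↔ x = ρ * t := fun {t} x => by
    constructor
    · intro hx; rw [← hx, ← mul_assoc, hρ2, one_mul]
    · intro hx; rw [hx, ← mul_assoc, hρ2, one_mul]
  have v : ∀ {t : G}, χ₁ (Additive.ofMul t) = 1 → χ₁ (Additive.ofMul (ρ * t)) = -1 := fun {t} ht => by
    rw [char_mul_sw2, hχ₁, ht]; norm_num
  have hfilt : (((Finset.univ.filter fun g : G => χ₁ (Additive.ofMul g) = 1) \ {t₁, t₂}) ∪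
      ({t₁, t₂} : Finset G).image (fun d => ρ * d)).filter (fun s => χ₁ (Additive.ofMul s) = -1) =
      {ρ * t₁, ρ * t₂} := by
    ext x
    simp only [Finset.mem_filter, AbelianSwap.mem_sdiff_union_image_iff hρ2, Finset.mem_univ, true_and,
      Finset.mem_insert, Finset.mem_singleton, e1]
    constructor
    · rintro ⟨hx | hx, hχx⟩
      · rw [hx.1] at hχx; norm_num at hχx
      · exact hx
    · rintro (hx | hx)
      · exact ⟨Or.inr (Or.inl hx), by rw [hx]; exact v ht₁⟩
      · exact ⟨Or.inr (Or.inr hx), by rw [hx]; exact v ht₂⟩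
  rw [hfilt, Finset.card_pair]
  exact fun heq => hne (mul_left_cancel heq)

omit [DecidableEq G] in
/-- **EXISTENCE OF RANK `2`** on every finite commutative group of exponent `2` with `ρ ≠ 1`: the kernel type of an
odd character. [cite: Kubota1965, §4 Lemma 2] [cite: Shimura1998, §8.4 Example (2)(A)] -/
theorem exists_isCMTypeWith_typeRank_eq_two (hexp : ∀ g : G, g ^ 2 = 1) (hρ1 : ρ ≠ 1) :
    ∃ T : Finset G, IsCMTypeWith ρ (T : Set G) ∧ typeRank G (T : Set G) = 2 := by
  have hρ2 : ρ * ρ = 1 := mul_self_eq_one_sw2 hexp ρ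
  obtain ⟨χ₁, hχ₁⟩ := exists_odd_sw2 (G := G) hρ1 hρ2
  exact ⟨_, isCMTypeWith_filter_eq_one hexp hρ2 hχ₁, typeRank_filter_eq_one_eq_two hexp hρ2 hχ₁⟩

/-- **EXISTENCE OF RANK `|G|/4 + 1`** on every finite commutative group of exponent `2` of order `≥ 16` (`ρ ≠ 1`):
two swaps of the kernel type of an odd character. [cite: Kubota1965, §4 Lemma 2] [cite: Dodson1984, §3.1.1 Theorem] -/
theorem exists_isCMTypeWith_typeRank_eq_card_div_four_add_one (hexp : ∀ g : G, g ^ 2 = 1) (hρ1 : ρ ≠ 1)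
    (h16 : 16 ≤ Fintype.card G) :
    ∃ T : Finset G, IsCMTypeWith ρ (T : Set G) ∧ typeRank G (T : Set G) = Fintype.card G / 4 + 1 := by
  have hρ2 : ρ * ρ = 1 := mul_self_eq_one_sw2 hexp ρ
  obtain ⟨χ₁, hχ₁⟩ := exists_odd_sw2 (G := G) hρ1 hρ2
  have hχ₁0 : χ₁ ≠ 0 := fun h0 => by rw [h0, AddChar.zero_apply] at hχ₁; norm_num at hχ₁
  have hcard := two_mul_card_filter_eq_one hexp hχ₁0
  have hlt : 1 < (Finset.univ.filter fun g : G => χ₁ (Additive.ofMul g) = 1).card := by omega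
  obtain ⟨t₁, ht₁, t₂, ht₂, hne⟩ := Finset.one_lt_card.1 hlt
  exact ⟨_, AbelianSwap.isCMTypeWith_pair_swap (isCMTypeWith_filter_eq_one hexp hρ2 hχ₁) ht₁ ht₂,
    typeRank_pair_swap_filter_eq_one hexp hρ2 (by omega) hχ₁ (Finset.mem_filter.1 ht₁).2
      (Finset.mem_filter.1 ht₂).2 hne⟩

end KernelType

end ExponentTwo

end CyclicCMType

end Literature.NumberTheory.ComplexMultiplication
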